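import Literature.Geometry.Riemannian.MetricFlowConcentration
import Mathlib.MeasureTheory.Measure.Prokhorov
import HarnessLib

/-!
# Existence of optimal couplings for the `W₁`-distance (Bamler 2023, §2.1–§2.2; Villani 2003,
# Thm. 1.3)

R. Bamler, *Compactness theory of the space of super Ricci flows*, Invent. Math. 233 (2023), §2.2,
Lemma (basic measure theory) (a), (d): probability measures on complete separable metric spaces
are tight, and tight families are weakly sequentially compact (Prokhorov) — used throughout §2.4
(weak limits of couplings, e.g. the Lemma on almost isometric couplings, whose proof starts with
*"We first show that the sequence `q_k` is tight … so … we may pass to a subsequence such that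
`q_k → q_∞` weakly, where `q_∞` is also a coupling between `μ₁, μ₂`"*). We record the
consequence that the infimum defining `d_{W₁}` (`wassersteinW1`, `MetricFlowConcentration.lean`)
is attained (Villani 2003, Theorem 1.3: existence of an optimal transference plan), via
Mathlib's Prokhorov theorem (`MeasureTheory.isCompact_closure_of_isTightMeasureSet`):

* `isTightMeasureSet_setOf_isCoupling` — the couplings of two probability measures on Polish
  spaces form a tight set;
* `isClosed_setOf_isCoupling` — and a closed subset of `ProbabilityMeasure (X₁ × X₂)`;
* `isCompact_setOf_isCoupling` — hence a compact one;
* `lowerSemicontinuous_lintegral_edist` — the transport cost `q ↦ ∫ d dq` is weakly lower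
  semicontinuous (supremum of the continuous functionals `q ↦ ∫ min(d, n) dq`,
  `iSup_min_natCast`);
* `exists_isCoupling_lintegral_edist_eq_wassersteinW1` — **existence of an optimal coupling**.

Everything is proved; no definitions, no named facts.

## References

* R. H. Bamler, *Compactness theory of the space of super Ricci flows*, Invent. Math. 233 (2023),
  §2.2, Lemma (basic measure theory) (a), (d); §2.4, proof of the Lemma (tightness and weak
  limits of couplings). [Bamler2023]
* C. Villani, *Topics in Optimal Transportation*, GSM 58 (AMS 2003), Theorem 1.3. [Villani2003]
-/

noncomputable section

open Set MeasureTheory Filter Topology BoundedContinuousFunction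
open scoped ENNReal NNReal

namespace Literature.Geometry.Riemannian

/-! ### Couplings form a compact set -/

section Compact

variable {X₁ X₂ : Type*} [MetricSpace X₁] [MeasurableSpace X₁] [BorelSpace X₁]
  [SecondCountableTopology X₁] [CompleteSpace X₁] [MetricSpace X₂] [MeasurableSpace X₂]
  [BorelSpace X₂] [SecondCountableTopology X₂] [CompleteSpace X₂]

/-- **Couplings of probability measures on Polish spaces form a tight set** (Bamler 2023, §2.4,
proof of the Lemma: `q_k(X₁ × X₂ ∖ K_{1,ε} × K_{2,ε}) ≤ μ₁(X₁ ∖ K_{1,ε}) + μ₂(X₂ ∖ K_{2,ε}) ≤ ε`),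
via `MeasureTheory.IsTightMeasureSet.prodMk` and the tightness of a single finite measure on a
Polish space. [cite: Bamler2023, §2.4, proof of the Lemma (tightness of couplings)] -/
theorem isTightMeasureSet_setOf_isCoupling (μ₁ : Measure X₁) (μ₂ : Measure X₂)
    [IsProbabilityMeasure μ₁] [IsProbabilityMeasure μ₂] :
    IsTightMeasureSet {q : Measure (X₁ × X₂) | IsCoupling μ₁ μ₂ q} := by
  refine IsTightMeasureSet.prodMk ((isTightMeasureSet_singleton (μ := μ₁)).subset ?_)
    ((isTightMeasureSet_singleton (μ := μ₂)).subset ?_)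
  · rintro _ ⟨q, hq, rfl⟩
    exact hq.2.1
  · rintro _ ⟨q, hq, rfl⟩
    exact hq.2.2

omit [CompleteSpace X₁] [CompleteSpace X₂] in
/-- **Couplings form a closed subset of `ProbabilityMeasure (X₁ × X₂)`** (weak limits of
couplings are couplings, Bamler 2023, §2.4, proof of the Lemma: *"`q_k → q_∞` weakly, where
`q_∞` is also a coupling"*): the marginal maps are continuous for weak convergence.
[cite: Bamler2023, §2.4, proof of the Lemma (weak limits of couplings)] -/
theorem isClosed_setOf_isCoupling (μ₁ : Measure X₁) (μ₂ : Measure X₂) [IsProbabilityMeasure μ₁]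
    [IsProbabilityMeasure μ₂] :
    IsClosed {q : ProbabilityMeasure (X₁ × X₂) | IsCoupling μ₁ μ₂ (q : Measure (X₁ × X₂))} := by
  have h : {q : ProbabilityMeasure (X₁ × X₂) | IsCoupling μ₁ μ₂ (q : Measure (X₁ × X₂))} =
      (fun q : ProbabilityMeasure (X₁ × X₂) ↦
          q.map continuous_fst.measurable.aemeasurable) ⁻¹' {⟨μ₁, inferInstance⟩} ∩
        (fun q : ProbabilityMeasure (X₁ × X₂) ↦
          q.map continuous_snd.measurable.aemeasurable) ⁻¹' {⟨μ₂, inferInstance⟩} := by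
    ext q
    simp only [mem_setOf_eq, mem_inter_iff, mem_preimage, mem_singleton_iff]
    rw [← ProbabilityMeasure.toMeasure_injective.eq_iff,
      ← ProbabilityMeasure.toMeasure_injective.eq_iff
        (a := q.map continuous_snd.measurable.aemeasurable),
      ProbabilityMeasure.toMeasure_map, ProbabilityMeasure.toMeasure_map]
    exact ⟨fun h ↦ ⟨h.2.1, h.2.2⟩, fun h ↦ ⟨inferInstance, h.1, h.2⟩⟩
  rw [h]
  exact (isClosed_singleton.preimage (ProbabilityMeasure.continuous_map continuous_fst)).inter
    (isClosed_singleton.preimage (ProbabilityMeasure.continuous_map continuous_snd))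

/-- **Couplings form a compact subset of `ProbabilityMeasure (X₁ × X₂)`** (Bamler 2023, §2.2,
Lemma (basic measure theory) (d) = Prokhorov, applied to the tight closed set of couplings).
[cite: Bamler2023, §2.2, Lemma (basic measure theory) (d)] -/
theorem isCompact_setOf_isCoupling (μ₁ : Measure X₁) (μ₂ : Measure X₂) [IsProbabilityMeasure μ₁]
    [IsProbabilityMeasure μ₂] :
    IsCompact {q : ProbabilityMeasure (X₁ × X₂) | IsCoupling μ₁ μ₂ (q : Measure (X₁ × X₂))} := by
  rw [← (isClosed_setOf_isCoupling μ₁ μ₂).closure_eq]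
  refine isCompact_closure_of_isTightMeasureSet
    ((isTightMeasureSet_setOf_isCoupling μ₁ μ₂).subset ?_)
  rintro _ ⟨q, hq, rfl⟩
  exact hq

end Compact

/-! ### Lower semicontinuity of the cost and existence of optimal couplings -/

section Optimal

variable {X : Type*} [MetricSpace X] [MeasurableSpace X] [BorelSpace X]
  [SecondCountableTopology X]

/-- `min(a, n) ↑ a` in `[0, ∞]`: `⨆ₙ min(a, n) = a`. [folklore] -/
theorem iSup_min_natCast (a : ℝ≥0∞) : ⨆ n : ℕ, min a n = a := by
  refine le_antisymm (iSup_le fun n ↦ min_le_left _ _) ?_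
  rcases eq_or_ne a ∞ with rfl | ha
  · simp only [top_le_iff, min_eq_right le_top]
    exact ENNReal.iSup_natCast
  · obtain ⟨N, hN⟩ := exists_nat_gt a.toReal
    refine le_iSup_of_le N (le_min le_rfl ?_)
    rw [← ENNReal.ofReal_toReal ha, ← ENNReal.ofReal_natCast]
    exact ENNReal.ofReal_le_ofReal hN.le

/-- **The transport cost is weakly lower semicontinuous**: `q ↦ ∫ d dq` on
`ProbabilityMeasure (X × X)` is the supremum over `n` of the weakly continuous functionals
`q ↦ ∫ min(d, n) dq` (`min(d, n)` is a bounded continuous function; monotone convergence).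
[folklore] [cite: Villani2003, proof of Theorem 1.3 (lower semicontinuity of the cost)] -/
theorem lowerSemicontinuous_lintegral_edist :
    LowerSemicontinuous fun q : ProbabilityMeasure (X × X) ↦
      ∫⁻ p, edist p.1 p.2 ∂(q : Measure (X × X)) := by
  -- the truncated distances `min(d, n)` as bounded continuous `ℝ≥0`-valued functions
  have hbd : ∀ (n : ℕ) (p p' : X × X),
      dist (min (nndist p.1 p.2) (n : ℝ≥0)) (min (nndist p'.1 p'.2) (n : ℝ≥0)) ≤ n + n := by
    intro n p p'
    rw [NNReal.dist_eq]
    have h1 : ((min (nndist p.1 p.2) n : ℝ≥0) : ℝ) ≤ n := by exact_mod_cast min_le_right _ _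
    have h2 : ((min (nndist p'.1 p'.2) n : ℝ≥0) : ℝ) ≤ n := by exact_mod_cast min_le_right _ _
    have h3 : (0 : ℝ) ≤ (min (nndist p.1 p.2) n : ℝ≥0) := NNReal.coe_nonneg _
    have h4 : (0 : ℝ) ≤ (min (nndist p'.1 p'.2) n : ℝ≥0) := NNReal.coe_nonneg _
    rw [abs_le]
    constructor <;> linarith
  set f : ℕ → (X × X →ᵇ ℝ≥0) := fun n ↦ BoundedContinuousFunction.mkOfBound
    ⟨fun p ↦ min (nndist p.1 p.2) n, (continuous_nndist.comp (continuous_fst.prodMk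
      continuous_snd) |>.min continuous_const)⟩ (n + n) (hbd n) with hf_def
  have hf : ∀ (n : ℕ) (p : X × X), ((f n p : ℝ≥0) : ℝ≥0∞) = min (edist p.1 p.2) n := by
    intro n p
    simp only [hf_def, BoundedContinuousFunction.mkOfBound_coe, ContinuousMap.coe_mk,
      edist_nndist, ENNReal.coe_min, ENNReal.coe_natCast]
  have h : (fun q : ProbabilityMeasure (X × X) ↦ ∫⁻ p, edist p.1 p.2 ∂(q : Measure (X × X))) =
      fun q : ProbabilityMeasure (X × X) ↦
        ⨆ n : ℕ, ∫⁻ p, ((f n p : ℝ≥0) : ℝ≥0∞) ∂(q : Measure (X × X)) := by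
    funext q
    rw [← lintegral_iSup (fun n ↦ by fun_prop) (fun m n hmn p ↦ ?_)]
    · refine lintegral_congr fun p ↦ ?_
      simp_rw [hf]
      exact (iSup_min_natCast _).symm
    · simp only [hf]
      exact min_le_min le_rfl (by exact_mod_cast hmn)
  rw [h]
  exact lowerSemicontinuous_iSup fun n ↦
    (ProbabilityMeasure.continuous_lintegral_boundedContinuousFunction _).lowerSemicontinuous

variable [CompleteSpace X]

/-- **Existence of an optimal coupling** (Villani 2003, Theorem 1.3; the weak-compactness
argument of Bamler 2023, §2.2 (d)/§2.4): for probability measures `μ, ν` on a complete separable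
metric space the infimum in `d_{W₁}(μ, ν) = inf_q ∫ d dq` is attained — the set of couplings is
weakly compact and nonempty (`μ ⊗ ν`) and the cost is weakly lower semicontinuous.
[cite: Villani2003, Theorem 1.3] [cite: Bamler2023, §2.2, Lemma (basic measure theory) (d)] -/
theorem exists_isCoupling_lintegral_edist_eq_wassersteinW1 (μ ν : Measure X)
    [IsProbabilityMeasure μ] [IsProbabilityMeasure ν] :
    ∃ q : Measure (X × X), IsCoupling μ ν q ∧ ∫⁻ p, edist p.1 p.2 ∂q = wassersteinW1 μ ν := by
  set S : Set (ProbabilityMeasure (X × X)) := {q | IsCoupling μ ν (q : Measure (X × X))} with hS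
  have hne : S.Nonempty := ⟨⟨μ.prod ν, inferInstance⟩, isCoupling_prod μ ν⟩
  obtain ⟨q₀, hq₀S, hmin⟩ := (lowerSemicontinuous_lintegral_edist.lowerSemicontinuousOn S).exists_isMinOn
    hne (isCompact_setOf_isCoupling μ ν)
  refine ⟨q₀, hq₀S, le_antisymm ?_ (wassersteinW1_le_lintegral hq₀S)⟩
  refine le_iInf fun q ↦ ?_
  haveI : IsProbabilityMeasure (q : Measure (X × X)) := q.2.1
  exact hmin (a := ⟨(q : Measure (X × X)), inferInstance⟩) q.2

end Optimal

end Literature.Geometry.Riemannian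

end
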